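import Mathlib
import HarnessLib
import Summits.HubbardSuperconductivity.HubbardSuperconductivity.Theorems.KLProgrammeKLRegimeEngineRowBPlainLineOfMomentumRep
import Summits.HubbardSuperconductivity.HubbardSuperconductivity.Theorems.KLProgrammeKLRegimeTorusL1ProductBumpWt

/-!
# Route `KLProgramme` — crux K3 ENGINE (stmt-HubbardSuperconductivity-20437 `KLRegimeEngineV17F2`), registration V2 (α1) image 27cd7ed0f55f17c0,
# ROW (b) `stub_engine_step_norms` (digest e78dfb33d2f7), binders #5 (E4) / #6 `hplainE1` BY TYPE, step 3: the weighted plain quartic lines of `𝒱ₙ[K]`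
# from a CANONICAL PRODUCT-BUMP representation of the `↑↓` Cooper kernel — the (T1w) bump data DISCHARGED by (T4)/(T4w), so the E1 producer supplies only
# a profile, radii, amplitudes, a normalisation and the remainder's weighted line (cell gate-hubbard-kl, seat p3 g25)

Step 2 (`…EngineRowBPlainLineOfMomentumRep`, p736868) pushed `hplainE1` to a momentum-representation family with GENERIC bumps carrying (T1w) data (rates, sizes,
supports, time/axis third differences).  (T4) `productBump_bumpData` and (T4w) `productBump_thirdDifferences` (k3c2-p3 g17) prove those data for the canonical
product bumps `B_{R₀,R₁}(q) = φ(q̃₁/R₀)·φ((q̃₂)₀/R₁)·φ((q̃₂)₁/R₁)` on `(ℤ/2M)¹×(ℤ/L)²` (`A = 1`, `#supp ≤ 64R₀R₁²`, third differences `κ³/R³`), in the rate form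
`s₀ = 4R₀/(κ·2M)`, `s₁ = 4R₁/(κ·L)`, `n₀ = κ³` (the algebra of `sum_wt_norm_charSum_productBump_le`).  Here:

* §1 **`wplainLine_klEffectiveAction_allStrings_of_productBumpRepresentation`** — any frame `K`, any `e₀ n`, weight scale `j`: a representation
  `kernel ℂ (𝒱ₙ[K]) 4 ((k,(↑,↓,↑,↓)),(+,+,−,−)) = Σ_{i∈S} a_i·κ'·[k̄₀+k̄₁ = k̄₂+k̄₃]·B_{R₀ⁱ,R₁ⁱ}(−(k̄₀+k̄₁)) + ρ` with ONE profile `φ ∈ C³` (`|φ| ≤ 1`, `φ = 0` off `(−1,1)`,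
  `|φ″| ≤ K₂`, `|φ‴| ≤ κ³`, `κ ≥ 1`), integer radii (`4R₀ⁱ ≤ 2M`, `2R₀ⁱ+6 ≤ 2M`, `4R₁ⁱ ≤ L`, `2R₁ⁱ+6 ≤ L`) at rates above the weight's (`Λ_jβ/(2M) ≤ 4R₀ⁱ/(κ·2M)`,
  `Λ_j ≤ 4R₁ⁱ/(κ·L)`) and a weighted remainder line `r` ⟹ `∀ τ q y`, line `≤ 2·(ε³·2(‖κ'‖(2M·L²)²)·√(6561988608·κ³)·(2M·L²)·Σ_{i∈S}‖a_i‖ + r)`;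
* §2 **`wplainLineFamily_klEng_of_productBumpFamily`** (`hprodRep ⟹ hplainE1` VERBATIM, U-currency, top level) and **`hE4_of_productBumpLevels`**
  (`hE4prod ⟹` the (E4) family of `hE₁`, ε-currency, every level `i ≤ n`) — so row (b) reads, with no further capstone,
  `A24a1G14.stub_engine_step_norms_of_E1data₃ (A24a1G14.hE₁_of_split hE2 (hE4_of_productBumpLevels hE4prod) hE6) ha hb hu₀ (wplainLineFamily_klEng_of_productBumpFamily hprodRep) hincr`.
Everything is proved; no definitions; nothing asserts any family, row (b), any stub of 20437, K3, U₀, the window or superconductivity.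
References: BGM 2006 §2.3 (2.17), (2.41a), §2.8 (2.81) footnote 1 [cite: BenfattoGiulianiMastropietro2006]; Katznelson, *Harmonic Analysis*, Ch. I §6.3.
-/

noncomputable section

namespace Summit.HubbardSuperconductivity.HubbardSuperconductivity.Theorems.EngineV8

set_option linter.dupNamespace false -- summit = problem name (single-conjunct summit), D-0017

open Classical
open Real Finset Complex Literature.MathematicalPhysics.QuantumLattice Literature.Probability.LatticeModels GrassmannAlgebra
open Summit.HubbardSuperconductivity.HubbardSuperconductivity.Theorems.KLProgrammeLegKernels
open Summit.HubbardSuperconductivity.HubbardSuperconductivity.Theorems.KLRegimeSplit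
open Summit.HubbardSuperconductivity.HubbardSuperconductivity.Theorems.KLRegimeWick
open Summit.HubbardSuperconductivity.HubbardSuperconductivity.Theorems.TorusFourierL2

variable {L M : ℕ} [NeZero L] [NeZero M]

/-! ## §1 Every label string from a canonical product-bump representation -/

/-- **THE WEIGHTED PLAIN FOUR-LEG LINE OF `𝒱ₙ[K]` AT EVERY LABEL STRING FROM A CANONICAL PRODUCT-BUMP REPRESENTATION** of the `↑↓` quartic momentum kernel:
the bumps are the canonical product bumps `q ↦ φ(q̃₁/R₀ⁱ)·φ((q̃₂)₀/R₁ⁱ)·φ((q̃₂)₁/R₁ⁱ)` of (T4)/(T4w) (ONE profile `φ ∈ C³`, `|φ| ≤ 1`, `φ = 0` off `(−1,1)`, `|φ″| ≤ K₂`,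
`|φ‴| ≤ κ³`, `κ ≥ 1`; integer radii `R₀ⁱ, R₁ⁱ ≥ 1` with `4R₀ⁱ ≤ 2M`, `2R₀ⁱ + 6 ≤ 2M`, `4R₁ⁱ ≤ L`, `2R₁ⁱ + 6 ≤ L`) whose rates dominate the weight's
(`Λ_jβ/(2M) ≤ 4R₀ⁱ/(κ·2M)`, `Λ_j ≤ 4R₁ⁱ/(κ·L)`); the (T1w) bump data are DISCHARGED (`productBump_bumpData`, `productBump_thirdDifferences`: `A = 1`, `n₀ = κ³`), so the
producer supplies only the profile, the radii, the amplitudes `a_i`, the normalisation `κ'` and the remainder's weighted line `r`: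
`∀ τ q y, line ≤ 2·(ε³·2(‖κ'‖(2M·L²)²)·√(6561988608·κ³)·(2M·L²)·Σ_{i∈S}‖a_i‖ + r)`. [cite: BenfattoGiulianiMastropietro2006, §2.3 (2.17), §2.8 (2.81) footnote 1] -/
theorem wplainLine_klEffectiveAction_allStrings_of_productBumpRepresentation {ι : Type*} {β : ℝ} (hβ : 0 < β) (U μ : ℝ) (K : TrigPolyC4v) (e₀ : ℝ)
    (n : ℕ) (φ : ℝ → ℝ) (hφ : ContDiff ℝ 3 φ) {K₂ : ℝ} (hK2 : ∀ t, |iteratedDeriv 2 φ t| ≤ K₂) {κ : ℝ} (hκ1 : 1 ≤ κ)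
    (hK3 : ∀ t, |iteratedDeriv 3 φ t| ≤ κ ^ 3) (hφ1 : ∀ t, |φ t| ≤ 1) (hφ0 : ∀ t, 1 ≤ |t| → φ t = 0)
    (S : Finset ι) (a : ι → ℂ) (κ' : ℂ) (R₀ R₁ : ι → ℕ) (hR₀ : ∀ i ∈ S, 0 < R₀ i) (hR₁ : ∀ i ∈ S, 0 < R₁ i)
    (hP : ∀ i ∈ S, 4 * R₀ i ≤ 2 * M) (hL : ∀ i ∈ S, 4 * R₁ i ≤ L) (hP' : ∀ i ∈ S, 2 * R₀ i + 6 ≤ 2 * M) (hL' : ∀ i ∈ S, 2 * R₁ i + 6 ≤ L)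
    (ρ : (Fin 4 → FreqMomentum L M) → ℂ)
    (hker : ∀ k : Fin 4 → FreqMomentum L M,
      kernel ℂ (klEffectiveAction L M β U μ K e₀ n) 4 (fun i => ((k i, (![0, 1, 0, 1] : Fin 4 → Fin 2) i), (![0, 0, 1, 1] : Fin 4 → Fin 2) i)) =
        ∑ i ∈ S, a i * (κ' * (if ((fun _ : Fin 1 => ((((k 0).1 : ℕ) : ZMod (2 * M)))), (k 0).2) + ((fun _ : Fin 1 => ((((k 1).1 : ℕ) : ZMod (2 * M)))), (k 1).2) = (((fun _ : Fin 1 => ((((k 2).1 : ℕ) : ZMod (2 * M)))), (k 2).2) : TorusSite 1 (2 * M) × TorusSite 2 L) + ((fun _ : Fin 1 => ((((k 3).1 : ℕ) : ZMod (2 * M)))), (k 3).2) then (fun Q => (fun q : TorusSite 1 (2 * M) × TorusSite 2 L => (((φ (((q.1 0).valMinAbs : ℝ) / R₀ i) * (φ (((q.2 0).valMinAbs : ℝ) / R₁ i) * φ (((q.2 1).valMinAbs : ℝ) / R₁ i)) : ℝ) : ℂ))) (-Q)) (((fun _ : Fin 1 => ((((k 0).1 : ℕ) : ZMod (2 * M)))),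 (k 0).2) + ((fun _ : Fin 1 => ((((k 1).1 : ℕ) : ZMod (2 * M)))), (k 1).2)) else 0)) + ρ k)
    (j : ℕ) (hts₀ : ∀ i ∈ S, klScale klE0 j * β / (2 * M) ≤ 4 * R₀ i / (κ * (2 * M : ℕ))) (hts₁ : ∀ i ∈ S, klScale klE0 j ≤ 4 * R₁ i / (κ * L))
    {r : ℝ}
    (hr : ∀ (q : Fin 4) (y : SpaceTimeIdx L M), imagTimeWeight β M ^ 3 *
      ∑ x ∈ univ.filter (fun x : Fin 4 → SpaceTimeIdx L M => x q = y),
        klScaleWt L M β j ((univ.image x).image (fun x : SpaceTimeIdx L M => (((((2 * (x.1 : ℕ) : ℕ)) : ZMod (2 * (2 * M)))), x.2))) *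
          ‖(fun (Ω : Fin 4 → SectorLeg 1) (x : Fin 4 → SpaceTimeIdx L M) =>
            ∑ k : Fin 4 → FreqMomentum L M, (∏ i, trivialMultiplier L M (Ω i).1.1 (k i) * hubbardPlaneWave L M β (Ω i).2 (k i) (x i)) * ρ k)
            (fun i : Fin 4 => ((((0 : Fin 1), (![0, 1, 0, 1] : Fin 4 → Fin 2) i) : Fin 1 × Fin 2), (![0, 0, 1, 1] : Fin 4 → Fin 2) i)) x‖ ≤ r)
    (τ : Fin 4 → SectorLeg 1) (q : Fin 4) (y : SpaceTimeIdx L M) :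
    imagTimeWeight β M ^ 3 *
        ∑ x ∈ univ.filter (fun x : Fin 4 → SpaceTimeIdx L M => x q = y),
          klScaleWt L M β j ((univ.image x).image (fun x : SpaceTimeIdx L M => (((((2 * (x.1 : ℕ) : ℕ)) : ZMod (2 * (2 * M)))), x.2))) *
            ‖sectorisedKernel L M β (trivialMultiplier L M) (klEffectiveAction L M β U μ K e₀ n) 4 τ x‖ ≤
      2 * (imagTimeWeight β M ^ 3 * (2 * (‖κ'‖ * ((((2 * M : ℕ) : ℝ) * (L : ℝ) ^ 2) ^ 2)) * (Real.sqrt (6561988608 * κ ^ 3) * (((2 * M : ℕ) : ℝ) * (L : ℝ) ^ 2))) *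
        ∑ i ∈ S, ‖a i‖ + r) := by
  have hκ0 : 0 < κ := lt_of_lt_of_le one_pos hκ1
  have hφ2 : ContDiff ℝ 2 φ := hφ.of_le (by norm_num)
  have hM0 : (0 : ℝ) < ((2 * M : ℕ) : ℝ) := by have := NeZero.ne M; positivity
  have hL0 : (0 : ℝ) < (L : ℝ) := Nat.cast_pos.2 (Nat.pos_of_ne_zero (NeZero.ne L))
  -- the canonical bumps and their (T1w) data in rate form
  set G : ι → TorusSite 1 (2 * M) × TorusSite 2 L → ℂ := (fun i q =>
    (((φ (((q.1 0).valMinAbs : ℝ) / R₀ i) * (φ (((q.2 0).valMinAbs : ℝ) / R₁ i) * φ (((q.2 1).valMinAbs : ℝ) / R₁ i)) : ℝ) : ℂ))) with hGdef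
  set s₀ : ι → ℝ := fun i => 4 * R₀ i / (κ * (2 * M : ℕ)) with hs₀
  set s₁ : ι → ℝ := fun i => 4 * R₁ i / (κ * L) with hs₁
  have hs₀pos : ∀ i ∈ S, 0 < s₀ i := fun i hi => by
    have := hR₀ i hi; simp only [hs₀]; positivity
  have hs₁pos : ∀ i ∈ S, 0 < s₁ i := fun i hi => by
    have := hR₁ i hi; simp only [hs₁]; positivity
  have hs₀1 : ∀ i ∈ S, s₀ i ≤ 1 := fun i hi => by
    simp only [hs₀]
    rw [div_le_one (by positivity)]
    have : (4 * R₀ i : ℝ) ≤ ((2 * M : ℕ) : ℝ) := by exact_mod_cast hP i hi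
    nlinarith
  have hs₁1 : ∀ i ∈ S, s₁ i ≤ 1 := fun i hi => by
    simp only [hs₁]
    rw [div_le_one (by positivity)]
    have : (4 * R₁ i : ℝ) ≤ L := by exact_mod_cast hL i hi
    nlinarith
  have hκne : κ ≠ 0 := hκ0.ne'
  have hs₀P : ∀ i ∈ S, s₀ i * ((2 * M : ℕ) : ℝ) = 4 * R₀ i / κ := fun i hi => by simp only [hs₀]; field_simp
  have hs₁L : ∀ i ∈ S, s₁ i * L = 4 * R₁ i / κ := fun i hi => by simp only [hs₁]; field_simp
  have h4₀ : ∀ i ∈ S, 4 / (s₀ i * ((2 * M : ℕ) : ℝ)) = κ / R₀ i := fun i hi => by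
    have hR : (0 : ℝ) < R₀ i := by exact_mod_cast hR₀ i hi
    rw [hs₀P i hi, div_div_eq_mul_div, div_eq_div_iff (by positivity) hR.ne']
    ring
  have h4₁ : ∀ i ∈ S, 4 / (s₁ i * L) = κ / R₁ i := fun i hi => by
    have hR : (0 : ℝ) < R₁ i := by exact_mod_cast hR₁ i hi
    rw [hs₁L i hi, div_div_eq_mul_div, div_eq_div_iff (by positivity) hR.ne']
    ring
  have hdata : ∀ i ∈ S, (∀ q, ‖G i q‖ ≤ 1) ∧ ((univ.filter fun q => G i q ≠ 0).card ≤ 64 * R₀ i * R₁ i ^ 2) := fun i hi => by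
    obtain ⟨hsup, hsupp, -, -⟩ := productBump_bumpData (P := 2 * M) (L := L) φ hφ2 hK2 hφ1 hφ0 (hR₀ i hi) (hR₁ i hi) (by have := hP' i hi; omega)
      (by have := hL' i hi; omega)
    exact ⟨hsup, hsupp⟩
  have hdiff : ∀ i ∈ S, (∀ q, ‖(fwdDiff ((fun _ : Fin 1 => (1 : ZMod (2 * M))), (0 : TorusSite 2 L)))^[3] (G i) q‖ ≤ κ ^ 3 / (R₀ i : ℝ) ^ 3) ∧
      (∀ q (d : Fin 2), ‖(fwdDiff ((0 : TorusSite 1 (2 * M)), (Pi.single d (1 : ZMod L) : TorusSite 2 L)))^[3] (G i) q‖ ≤ κ ^ 3 / (R₁ i : ℝ) ^ 3) :=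
    fun i hi => productBump_thirdDifferences (P := 2 * M) (L := L) φ hφ hK3 hφ1 hφ0 (hR₀ i hi) (hR₁ i hi) (hP' i hi) (hL' i hi)
  have hmain := wplainLine_klEffectiveAction_allStrings_of_momentumRepresentation hβ U μ K e₀ n S a κ' G ρ hker s₀ s₁ (fun _ => (1 : ℝ))
    (fun i => 64 * R₀ i * R₁ i ^ 2) (n₀ := κ ^ 3) (r := r) (by positivity) hs₀pos hs₀1 hs₁pos hs₁1 (fun _ _ => zero_le_one)
    (fun i hi => by
      rw [hs₀P i hi, hs₁L i hi]
      have hKK : κ ^ 3 * (4 * (R₀ i : ℝ) / κ) * (4 * (R₁ i : ℝ) / κ) ^ 2 = 64 * R₀ i * R₁ i ^ 2 := by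
        field_simp
        ring
      rw [hKK]; push_cast; exact le_rfl)
    (fun i hi => (hdata i hi).2) (fun i hi => (hdata i hi).1)
    (fun i hi q => ((hdiff i hi).1 q).trans (le_of_eq (by rw [h4₀ i hi, div_pow, one_mul])))
    (fun i hi q d => ((hdiff i hi).2 q d).trans (le_of_eq (by rw [h4₁ i hi, div_pow, one_mul])))
    j hts₀ hts₁ hr τ q y
  simpa only [mul_one] using hmain


/-! ## §2 The top-level family (`hplainE1`, U-currency) and the level-by-level (E4) family (ε-currency) from PRODUCT-BUMP representations -/

section Families

open Summit.HubbardSuperconductivity.HubbardSuperconductivity.Theorems.DispersionFlow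

/-- **`hplainE1` FROM A PRODUCT-BUMP REPRESENTATION FAMILY**: under EXACTLY `E4FlowAt`'s binders (no osc rows), if the degree-4 momentum kernel of `𝒱ₙ[Kₙ]` on the
Cooper pattern `(ψ⁺↑, ψ⁺↓, ψ⁻↑, ψ⁻↓)` is `Σ_{i∈S} amp_i·κ'·[k̄₀+k̄₁ = k̄₂+k̄₃]·B_{R₀ⁱ,R₁ⁱ}(−(k̄₀+k̄₁)) + ρ` with CANONICAL PRODUCT BUMPS
`B_{R₀,R₁}(q) = φ(q̃₁/R₀)φ((q̃₂)₀/R₁)φ((q̃₂)₁/R₁)` (one profile `φ ∈ C³`, `|φ| ≤ 1`, `φ = 0` off `(−1,1)`, `|φ″| ≤ K₂`, `|φ‴| ≤ κ³`, `κ ≥ 1`; radii with `4R₀ⁱ ≤ 2M`,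
`2R₀ⁱ + 6 ≤ 2M`, `4R₁ⁱ ≤ L`, `2R₁ⁱ + 6 ≤ L` and rates above the weight's: `Λₙβ/(2M) ≤ 4R₀ⁱ/(κ·2M)`, `Λₙ ≤ 4R₁ⁱ/(κ·L)`), `klScaleWt_n`-weighted remainder line `≤ r`,
and `2·(ε³·2(‖κ'‖(2M·L²)²)·√(6561988608·κ³)·(2M·L²)·Σ‖amp_i‖ + r) ≤ klE0·(a·|U| + bfun·(Klam·U)²)`, THEN the `hplainE1` family of
`A24a1G14.stub_engine_step_norms_of_E1data₃` holds VERBATIM — the producer supplies profile, radii, amplitudes, normalisation and the remainder's line ONLY.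
Row (b) then reads `stub_engine_step_norms_of_E1data₃ hE₁ ha hb hu₀ (wplainLineFamily_klEng_of_productBumpFamily hprodRep) hincr`.
[cite: BenfattoGiulianiMastropietro2006, §2.3 (2.17), §2.8 (2.81), (2.41a)] -/
theorem wplainLineFamily_klEng_of_productBumpFamily {a : ℝ} {bfun u₀ : GeoConsts → SplitConsts → RenConsts → EngConsts → ℝ → ℝ}
    (hprodRep : ∀ (G : GeoConsts), G.WF → ∀ (P : SplitConsts) (R : RenConsts) (Q : EngConsts) (cc : ℝ), P.WF → R.WF2 → Q.WF → 0 < cc →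
      cc ≤ klEngC₃6 P R → ∀ μ ∈ klWindowC, ∀ U : ℝ, 0 < U → U ≤ u₀ G P R Q cc →
      ∀ β : ℝ, klBetaMin ≤ β → β ≤ Real.exp (cc / U ^ 2) →
      ∀ (L M : ℕ) [NeZero L] [NeZero M], klEngL₃ β U ≤ L → klEngM₃ β U L ≤ M →
      ∀ n : ℕ, 1 ≤ n → n ≤ nScales β + 1 → IsKLRegime U cc (-(n : ℤ)) →
        HistP klPredsV17F2 L M G P Q R β U μ 0 n → FrameOK R U (nScales β) μ (klFlowFrameU L M β U μ n) →
        ∃ (φ : ℝ → ℝ) (K₂ κ : ℝ) (S : Finset ℕ) (amp : ℕ → ℂ) (κ' : ℂ) (R₀ R₁ : ℕ → ℕ) (ρ : (Fin 4 → FreqMomentum L M) → ℂ) (r : ℝ),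
          ContDiff ℝ 3 φ ∧ (∀ t, |iteratedDeriv 2 φ t| ≤ K₂) ∧ 1 ≤ κ ∧ (∀ t, |iteratedDeriv 3 φ t| ≤ κ ^ 3) ∧ (∀ t, |φ t| ≤ 1) ∧
          (∀ t, 1 ≤ |t| → φ t = 0) ∧ (∀ l ∈ S, 0 < R₀ l) ∧ (∀ l ∈ S, 0 < R₁ l) ∧ (∀ l ∈ S, 4 * R₀ l ≤ 2 * M) ∧ (∀ l ∈ S, 4 * R₁ l ≤ L) ∧
          (∀ l ∈ S, 2 * R₀ l + 6 ≤ 2 * M) ∧ (∀ l ∈ S, 2 * R₁ l + 6 ≤ L) ∧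
          (∀ k : Fin 4 → FreqMomentum L M,
            kernel ℂ (klEffectiveAction L M β U μ (klFlowFrameU L M β U μ n) klE0 n) 4
                (fun d => ((k d, (![0, 1, 0, 1] : Fin 4 → Fin 2) d), (![0, 0, 1, 1] : Fin 4 → Fin 2) d)) =
              ∑ l ∈ S, amp l * (κ' * (if ((fun _ : Fin 1 => ((((k 0).1 : ℕ) : ZMod (2 * M)))), (k 0).2) + ((fun _ : Fin 1 => ((((k 1).1 : ℕ) : ZMod (2 * M)))), (k 1).2) = (((fun _ : Fin 1 => ((((k 2).1 : ℕ) : ZMod (2 * M)))), (k 2).2) : TorusSite 1 (2 * M) × TorusSite 2 L) + ((fun _ : Fin 1 => ((((k 3).1 : ℕ) : ZMod (2 * M)))), (k 3).2) then (fun Q => (fun q : TorusSite 1 (2 * M) × TorusSite 2 L => (((φ (((q.1 0).valMinAbs : ℝ) / R₀ l) * (φ (((q.2 0).valMinAbs : ℝ) / R₁ l) * φ (((q.2 1).valMinAbs : ℝ) / R₁ l)) : ℝ) : ℂ))) (-Q)) (((fun _ : Fin 1 => ((((k 0).1 : ℕ) : ZMod (2 * M)))), (k 0).2) + ((fun _ :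 Fin 1 => ((((k 1).1 : ℕ) : ZMod (2 * M)))), (k 1).2)) else 0)) + ρ k) ∧
          (∀ l ∈ S, klScale klE0 n * β / (2 * M) ≤ 4 * R₀ l / (κ * (2 * M : ℕ))) ∧ (∀ l ∈ S, klScale klE0 n ≤ 4 * R₁ l / (κ * L)) ∧
          (∀ (q : Fin 4) (y : SpaceTimeIdx L M), imagTimeWeight β M ^ 3 *
            ∑ x ∈ univ.filter (fun x : Fin 4 → SpaceTimeIdx L M => x q = y),
              klScaleWt L M β n ((univ.image x).image (fun x : SpaceTimeIdx L M => (((((2 * (x.1 : ℕ) : ℕ)) : ZMod (2 * (2 * M)))), x.2))) *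
                ‖(fun (Ω : Fin 4 → SectorLeg 1) (x : Fin 4 → SpaceTimeIdx L M) =>
                  ∑ k : Fin 4 → FreqMomentum L M, (∏ d, trivialMultiplier L M (Ω d).1.1 (k d) * hubbardPlaneWave L M β (Ω d).2 (k d) (x d)) * ρ k)
                  (fun d : Fin 4 => ((((0 : Fin 1), (![0, 1, 0, 1] : Fin 4 → Fin 2) d) : Fin 1 × Fin 2), (![0, 0, 1, 1] : Fin 4 → Fin 2) d)) x‖ ≤ r) ∧
          2 * (imagTimeWeight β M ^ 3 * (2 * (‖κ'‖ * ((((2 * M : ℕ) : ℝ) * (L : ℝ) ^ 2) ^ 2)) *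
                (Real.sqrt (6561988608 * κ ^ 3) * (((2 * M : ℕ) : ℝ) * (L : ℝ) ^ 2))) * ∑ l ∈ S, ‖amp l‖ + r) ≤
            klE0 * (a * |U| + bfun G P R Q cc * (P.Klam * U) ^ 2)) :
    ∀ (G : GeoConsts), G.WF → ∀ (P : SplitConsts) (R : RenConsts) (Q : EngConsts) (cc : ℝ), P.WF → R.WF2 → Q.WF → 0 < cc →
      cc ≤ klEngC₃6 P R → ∀ μ ∈ klWindowC, ∀ U : ℝ, 0 < U → U ≤ u₀ G P R Q cc →
      ∀ β : ℝ, klBetaMin ≤ β → β ≤ Real.exp (cc / U ^ 2) →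
      ∀ (L M : ℕ) [NeZero L] [NeZero M], klEngL₃ β U ≤ L → klEngM₃ β U L ≤ M →
      ∀ n : ℕ, 1 ≤ n → n ≤ nScales β + 1 → IsKLRegime U cc (-(n : ℤ)) →
        HistP klPredsV17F2 L M G P Q R β U μ 0 n → FrameOK R U (nScales β) μ (klFlowFrameU L M β U μ n) →
        ∀ (τ' : Fin 4 → SectorLeg 1) (y : SpaceTimeIdx L M),
          imagTimeWeight β M ^ 3 * ∑ x' ∈ univ.filter (fun x' : Fin 4 → SpaceTimeIdx L M => x' 0 = y),
            klScaleWt L M β n ((univ.image x').image (fun x : SpaceTimeIdx L M => (((((2 * (x.1 : ℕ) : ℕ)) : ZMod (2 * (2 * M)))), x.2))) *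
              ‖sectorisedKernel L M β (trivialMultiplier L M)
                (klEffectiveAction L M β U μ (klFlowFrameU L M β U μ n) klE0 n) 4 τ' x'‖ ≤
          klE0 * (a * |U| + bfun G P R Q cc * (P.Klam * U) ^ 2) := by
  intro G hG P R Q cc hP hR hQ hcc hcc6 μ hμ U hU hUu β hβ hβc L M _ _ hL hM n hn1 hn hreg hhist hfr τ' y
  obtain ⟨φ, K₂, κ, S, amp, κ', R₀, R₁, ρ, r, hφ, hK2, hκ1, hK3, hφ1, hφ0, hR₀, hR₁, hP4, hL4, hP6, hL6, hker, hts₀, hts₁, hr, hclose⟩ :=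
    hprodRep G hG P R Q cc hP hR hQ hcc hcc6 μ hμ U hU hUu β hβ hβc L M hL hM n hn1 hn hreg hhist hfr
  have hβ0 : 0 < β := KLRegimeSplit.pos_of_klBetaMin_le hβ
  exact (wplainLine_klEffectiveAction_allStrings_of_productBumpRepresentation hβ0 U μ (klFlowFrameU L M β U μ n) klE0 n φ hφ hK2 hκ1 hK3 hφ1 hφ0
    S amp κ' R₀ R₁ hR₀ hR₁ hP4 hL4 hP6 hL6 ρ hker n hts₀ hts₁ hr τ' 0 y).trans hclose

/-- **THE (E4) FAMILY OF `hE₁` FROM LEVEL-BY-LEVEL PRODUCT-BUMP REPRESENTATIONS** (ε-currency): under `hE₁`'s binders, a product-bump representation of the `↑↓`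
quartic momentum kernel of `𝒱_i[Kₙ]` at every level `1 ≤ i ≤ n` (rates above `(Λ_iβ/(2M), Λ_i)`, closure `≤ s₄·ε_i`) gives the (E4) family with the same `s₄` and
doors — the `hE4` slot of `A24a1G14.hE₁_of_split`. [cite: BenfattoGiulianiMastropietro2006, §2.3 (2.17), §2.8 (2.81), (2.41a)] -/
theorem hE4_of_productBumpLevels
    (hE4prod : ∀ (P : SplitConsts) (R : RenConsts), P.WF → R.WF2 →
      ∃ s₄ : ℝ, 0 ≤ s₄ ∧ ∃ cE UE : ℝ, 0 < cE ∧ 0 < UE ∧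
      ∀ (Q : EngConsts) (cc : ℝ), 0 < cc → cc ≤ klEngC₃6 P R → cc ≤ cE →
      ∀ μ ∈ klWindowC, ∀ U : ℝ, 0 < U → U ≤ klEngU₀10 P R cc → U ≤ UE →
      ∀ β : ℝ, klBetaMin ≤ β → β ≤ Real.exp (cc / U ^ 2) →
      ∀ (L M : ℕ) [NeZero L] [NeZero M], klEngL₄ P R β U ≤ L → klEngM₃ β U L ≤ M →
      ∀ n : ℕ, 1 ≤ n → n ≤ nScales β + 1 → IsKLRegime U cc (-(n : ℤ)) →
      HistP klPredsV17F2 L M klEngGeo14 P Q R β U μ 0 n →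
      (∀ m, 1 ≤ m → m < n → FlowPieceOscAt L M (klReadOscC P R) β U μ m) →
      FrameOK R U (nScales β) μ (klFlowFrameU L M β U μ n) →
      (∀ j ≤ n, LevelsUExportMixedAt L M (klCU2 P R (klEngQ7 P R)) P β U μ j) →
      ∀ i, 1 ≤ i → i ≤ n →
        ∃ (φ : ℝ → ℝ) (K₂ κ : ℝ) (S : Finset ℕ) (amp : ℕ → ℂ) (κ' : ℂ) (R₀ R₁ : ℕ → ℕ) (ρ : (Fin 4 → FreqMomentum L M) → ℂ) (r : ℝ),
          ContDiff ℝ 3 φ ∧ (∀ t, |iteratedDeriv 2 φ t| ≤ K₂) ∧ 1 ≤ κ ∧ (∀ t, |iteratedDeriv 3 φ t| ≤ κ ^ 3) ∧ (∀ t, |φ t| ≤ 1) ∧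
          (∀ t, 1 ≤ |t| → φ t = 0) ∧ (∀ l ∈ S, 0 < R₀ l) ∧ (∀ l ∈ S, 0 < R₁ l) ∧ (∀ l ∈ S, 4 * R₀ l ≤ 2 * M) ∧ (∀ l ∈ S, 4 * R₁ l ≤ L) ∧
          (∀ l ∈ S, 2 * R₀ l + 6 ≤ 2 * M) ∧ (∀ l ∈ S, 2 * R₁ l + 6 ≤ L) ∧
          (∀ k : Fin 4 → FreqMomentum L M,
            kernel ℂ (klEffectiveAction L M β U μ (klFlowFrameU L M β U μ n) klE0 i) 4
                (fun d => ((k d, (![0, 1, 0, 1] : Fin 4 → Fin 2) d), (![0, 0, 1, 1] : Fin 4 → Fin 2) d)) =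
              ∑ l ∈ S, amp l * (κ' * (if ((fun _ : Fin 1 => ((((k 0).1 : ℕ) : ZMod (2 * M)))), (k 0).2) + ((fun _ : Fin 1 => ((((k 1).1 : ℕ) : ZMod (2 * M)))), (k 1).2) = (((fun _ : Fin 1 => ((((k 2).1 : ℕ) : ZMod (2 * M)))), (k 2).2) : TorusSite 1 (2 * M) × TorusSite 2 L) + ((fun _ : Fin 1 => ((((k 3).1 : ℕ) : ZMod (2 * M)))), (k 3).2) then (fun Q => (fun q : TorusSite 1 (2 * M) × TorusSite 2 L => (((φ (((q.1 0).valMinAbs : ℝ) / R₀ l) * (φ (((q.2 0).valMinAbs : ℝ) / R₁ l) * φ (((q.2 1).valMinAbs : ℝ) / R₁ l)) : ℝ) : ℂ))) (-Q)) (((fun _ : Fin 1 => ((((k 0).1 : ℕ) : ZMod (2 * M)))), (k 0).2) + ((fun _ : Fin 1 => ((((k 1).1 : ℕ) : ZMod (2 * M)))), (k 1).2)) else 0)) + ρ k) ∧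
          (∀ l ∈ S, klScale klE0 i * β / (2 * M) ≤ 4 * R₀ l / (κ * (2 * M : ℕ))) ∧ (∀ l ∈ S, klScale klE0 i ≤ 4 * R₁ l / (κ * L)) ∧
          (∀ (q : Fin 4) (y : SpaceTimeIdx L M), imagTimeWeight β M ^ 3 *
            ∑ x ∈ univ.filter (fun x : Fin 4 → SpaceTimeIdx L M => x q = y),
              klScaleWt L M β i ((univ.image x).image (fun x : SpaceTimeIdx L M => (((((2 * (x.1 : ℕ) : ℕ)) : ZMod (2 * (2 * M)))), x.2))) *
                ‖(fun (Ω : Fin 4 → SectorLeg 1) (x : Fin 4 → SpaceTimeIdx L M) =>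
                  ∑ k : Fin 4 → FreqMomentum L M, (∏ d, trivialMultiplier L M (Ω d).1.1 (k d) * hubbardPlaneWave L M β (Ω d).2 (k d) (x d)) * ρ k)
                  (fun d : Fin 4 => ((((0 : Fin 1), (![0, 1, 0, 1] : Fin 4 → Fin 2) d) : Fin 1 × Fin 2), (![0, 0, 1, 1] : Fin 4 → Fin 2) d)) x‖ ≤ r) ∧
          2 * (imagTimeWeight β M ^ 3 * (2 * (‖κ'‖ * ((((2 * M : ℕ) : ℝ) * (L : ℝ) ^ 2) ^ 2)) *
                (Real.sqrt (6561988608 * κ ^ 3) * (((2 * M : ℕ) : ℝ) * (L : ℝ) ^ 2))) * ∑ l ∈ S, ‖amp l‖ + r) ≤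
            s₄ * epsCoupling P U i) :
    ∀ (P : SplitConsts) (R : RenConsts), P.WF → R.WF2 →
      ∃ s₄ : ℝ, 0 ≤ s₄ ∧ ∃ cE UE : ℝ, 0 < cE ∧ 0 < UE ∧
      ∀ (Q : EngConsts) (cc : ℝ), 0 < cc → cc ≤ klEngC₃6 P R → cc ≤ cE →
      ∀ μ ∈ klWindowC, ∀ U : ℝ, 0 < U → U ≤ klEngU₀10 P R cc → U ≤ UE →
      ∀ β : ℝ, klBetaMin ≤ β → β ≤ Real.exp (cc / U ^ 2) →
      ∀ (L M : ℕ) [NeZero L] [NeZero M], klEngL₄ P R β U ≤ L → klEngM₃ β U L ≤ M →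
      ∀ n : ℕ, 1 ≤ n → n ≤ nScales β + 1 → IsKLRegime U cc (-(n : ℤ)) →
      HistP klPredsV17F2 L M klEngGeo14 P Q R β U μ 0 n →
      (∀ m, 1 ≤ m → m < n → FlowPieceOscAt L M (klReadOscC P R) β U μ m) →
      FrameOK R U (nScales β) μ (klFlowFrameU L M β U μ n) →
      (∀ j ≤ n, LevelsUExportMixedAt L M (klCU2 P R (klEngQ7 P R)) P β U μ j) →
      ∀ i, 1 ≤ i → i ≤ n → ∀ (q : Fin 4) (τ' : Fin 4 → SectorLeg 1) (y' : SpaceTimeIdx L M),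
        imagTimeWeight β M ^ 3 * ∑ x' ∈ univ.filter (fun x' : Fin 4 → SpaceTimeIdx L M => x' q = y'),
          klScaleWt L M β i ((univ.image x').image (fun x : SpaceTimeIdx L M => (((((2 * (x.1 : ℕ) : ℕ)) : ZMod (2 * (2 * M)))), x.2))) *
            ‖sectorisedKernel L M β (trivialMultiplier L M) (klEffectiveAction L M β U μ (klFlowFrameU L M β U μ n) klE0 i) 4 τ' x'‖ ≤ s₄ * epsCoupling P U i := by
  intro P R hP hR
  obtain ⟨s₄, hs₄, cE, UE, hcE0, hUE0, h⟩ := hE4prod P R hP hR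
  refine ⟨s₄, hs₄, cE, UE, hcE0, hUE0, ?_⟩
  intro Q cc hcc hcc6 hcE μ hμ U hU hU10 hUE β hβ hβc L M _ _ hL hM n hn1 hn hreg hhist hosc hfr hlev i hi1 hin q τ' y'
  obtain ⟨φ, K₂, κ, S, amp, κ', R₀, R₁, ρ, r, hφ, hK2, hκ1, hK3, hφ1, hφ0, hR₀, hR₁, hP4, hL4, hP6, hL6, hker, hts₀, hts₁, hr, hclose⟩ :=
    h Q cc hcc hcc6 hcE μ hμ U hU hU10 hUE β hβ hβc L M hL hM n hn1 hn hreg hhist hosc hfr hlev i hi1 hin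
  have hβ0 : 0 < β := KLRegimeSplit.pos_of_klBetaMin_le hβ
  exact (wplainLine_klEffectiveAction_allStrings_of_productBumpRepresentation hβ0 U μ (klFlowFrameU L M β U μ n) klE0 i φ hφ hK2 hκ1 hK3 hφ1 hφ0
    S amp κ' R₀ R₁ hR₀ hR₁ hP4 hL4 hP6 hL6 ρ hker i hts₀ hts₁ hr τ' q y').trans hclose

end Families

end Summit.HubbardSuperconductivity.HubbardSuperconductivity.Theorems.EngineV8

end
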